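import Literature.NumberTheory.EllipticCurves.SkinnerUrban2014.PAdicUnitPeriodRatioProofs
import Literature.NumberTheory.EllipticCurves.EmertonPollackWeston2006.MultiplicativeToGoodOrdinaryOddPrime
import Literature.NumberTheory.EllipticCurves.YanZhu2026.CyclotomicMainTheoremRational
import HarnessLib

set_option linter.dupNamespace false -- `…BirchSwinnertonDyer.BirchSwinnertonDyer…` is the cell's nested layout (D-0017)
set_option autoImplicit false

/-!
# Crux 19064 `X11aLowerHalf` (route `PrintX11a`, rev 10), skeleton of record r9 `Cruxes/X11aLowerHalf/Lines/birth.lean`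
# (sha16 46733fc280dcf86f): `stub_partnerFactsLower` — FIVE named facts — from FOUR printed inputs and Mazur Cor. 4.1
# (LADDER-BSD D-0154 (2) INPUTS, desk `pub/bsd-wall/bsd-inputs`, INPUTS-LIST-2 row 11 X11a; tranche entry T21 of ADDENDUM-15 §Z)

`--supports stmt-BirchSwinnertonDyer-19064` (helper mode).  Conjunct 3 of r9's `stub_partnerFactsLower`
(`realPeriodRat_eq_unit_mul_plusPeriod_three`, INPUTS-LIST-2 F6: the period unit at the good prime 3, `E[3]` irreducible) is a THEOREM of the
tree GIVEN conjunct 13 of r9's `stub_twentyFactsLower` (`mazur_not_dvd_maninConstant_of_odd`, INPUTS-LIST-2 F7, Mazur 1978 Cor. 4.1), by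
`Literature.NumberTheory.EllipticCurves.SkinnerUrban2014.realPeriodRat_eq_unit_mul_plusPeriod_three_of_mazur` (PAdicUnitPeriodRatioProofs.lean:586).
After this file the displayed printed inputs of the two print stubs of r9 are 4 + 20 = 24 distinct named facts (was 25 distinct: F6 is no longer
displayed); the lead (bsd-line-x11a-p1) may re-cut `stub_partnerFactsLower` to four conjuncts in r10 and rebuild the five-conjunct bundle `hQ` of
`ThreePartner.x11aLowerHalf_of_printFactsLower_of_partnerFacts_of_muAnFive_of_partner_of_tresRamifie` through `partnerFactsLower_of_four_of_mazur`.

Honest framing: CONDITIONAL on the four prints and on Mazur Cor. 4.1 as typed; pure glue; closes nothing by itself; no crux of substance and no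
summit statement is proved; the Birch–Swinnerton-Dyer conjecture is NOT proved by any of this.
References: [Mazur1978] Cor. 4.1; [GreenbergVatsal2000] §3 Remark (3.4); [EmertonPollackWeston2006] Thm. 1, Cor. 5.1.4 (arXiv:math/0404484
pp. 2, 30); [YanZhu2024MainConjNonCM] Thm. 4.9.
-/

namespace Summit.BirchSwinnertonDyer.BirchSwinnertonDyer.Theorems.PrintX11a.InputsPartnerFacts

open Literature.NumberTheory.EllipticCurves Literature.NumberTheory.EllipticCurves.ModularForms
  Literature.NumberTheory.EllipticCurves.SkinnerUrban2014

/-- **r9's `stub_partnerFactsLower` (five conjuncts, VERBATIM) ⟸ FOUR printed inputs (EPW Cor. 5.1.4 · Yan–Zhu Thm. 4.9 · EPW Thm. 1 alg ·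
EPW Thm. 1 an) and Mazur Cor. 4.1** (conjunct 13 of `stub_twentyFactsLower`).  CONDITIONAL; closes nothing; BSD is not proved.
[cite: Mazur1978, Cor. 4.1] [cite: EmertonPollackWeston2006, Thm. 1, Cor. 5.1.4] [cite: YanZhu2024MainConjNonCM, Thm. 4.9] -/
theorem partnerFactsLower_of_four_of_mazur
    (h : EmertonPollackWeston2006.cor514_transfer_of_goodOrdinary_odd ∧ YanZhu2026.thm49_charIdeal_eq_padicLFunction ∧
      EmertonPollackWeston2006.thm1_muAlg_transfer_goodOrdinary_of_mult_odd ∧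
      EmertonPollackWeston2006.thm1_muAn_transfer_goodOrdinary_of_mult_odd)
    (hM : mazur_not_dvd_maninConstant_of_odd) :
    EmertonPollackWeston2006.cor514_transfer_of_goodOrdinary_odd ∧ YanZhu2026.thm49_charIdeal_eq_padicLFunction ∧
    realPeriodRat_eq_unit_mul_plusPeriod_three ∧ EmertonPollackWeston2006.thm1_muAlg_transfer_goodOrdinary_of_mult_odd ∧
    EmertonPollackWeston2006.thm1_muAn_transfer_goodOrdinary_of_mult_odd :=
  ⟨h.1, h.2.1, realPeriodRat_eq_unit_mul_plusPeriod_three_of_mazur hM, h.2.2.1, h.2.2.2⟩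

end Summit.BirchSwinnertonDyer.BirchSwinnertonDyer.Theorems.PrintX11a.InputsPartnerFacts
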